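import Summits.ResolutionOfSingularities.ResolutionOfSingularities.Theorems.PurelyInseparableDim4ResConeLightResidualFive
import HarnessLib
import HarnessLib.Audit.Tags

/-!
# Purely inseparable four-folds — the C∞ ASSEMBLY at `p = 5`, `d = 4`, LAYER 1: an eventually constant chart
# kills the light pair regime, and K2(5) shrinks to «no d = 2 light trap ∧ no binary-cone trap»
# (K2(p) lane, slice B, brick K24c; cell `res-dim4-pi`)

[OURS · counted 0 · cell `res-dim4-pi` · K2(p) lane holder res-dim4-p-12 g3's brick (K24c) «THE C∞ ASSEMBLY
`no_light_pair_tail_four_five`» by signature (bus 2026-08-29 02:16Z), seat res-dim4-p-3 g3.]  Pure logic over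
res-dim4-p-2's K14 light-slices binder; NOTHING here proves K2(5), K2(p), `NoIsolatedTrap p p` or resolution of
singularities in dimension ≥ 4 / characteristic `p`.  AI kernel work, weaker than expert review.

The C∞ regime of the light slice-B stretch at `p = 5` is the constant-shade-`4` power-cone chain with two boundary
letters of weight `1` (idea-4's I-4-7 class C∞).  Its kill is assembled from three inputs still in flight —
res-dim4-p-2 g4's K28 ENTRY (both letters stretch-born from some `k₁`), res-dim4-p-5 g3's K24b FRAME (pure-corner steps
in the Tschirnhaus jet frame, flags ⟺ tables) and res-dim4-p-9 g3's K24b-α GAME (letter-change lemma ⇒ eventually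
constant chart).  LAYER 1 (this file) is the part that does not depend on their shapes:
* **`no_light_pair_tail_four_five_of_eventuallyConst (hConst)`** — if every witnessed isolated above-floor
  `Step0 5` chain of constant shade `4` and `e_G ≡ 3` has an EVENTUALLY CONSTANT CHART LETTER, then no `d = 4` light
  power-cone trap exists (its defining `(6,6)`-satellite recurrence needs `j (k+1) ≠ j k` infinitely often).
* **`noAboveFloorTrap_five_iff_residual_two_of (hT2) (hConst)`** — with res-dim4-p-3's K27b
  (`noAboveFloorTrap_five_iff_residual_of_T2`): modulo the two-slot killer `hT2` (K24a) and the C∞ constancy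
  `hConst`, **K2(5) ⟺ (no `d = 2` light power-cone trap) ∧ (no binary-cone trap)** — the holder's slice-B end-state
  sentence for `p = 5`.
LAYER 2 (`eventuallyConst_chart_four_five_of (hEntry) (hFrame) (hGame)`, discharging `hConst`) follows the owners'
announce lines.
bears_on: LADDER-RESOLUTION:D157-DOOR2 (res-dim4-pi · K2(p) · slice B · K24c).  Supports
stmt-ResolutionOfSingularities-16155 (helper).
-/

set_option linter.dupNamespace false -- mandated namespace of this single-conjunct summit

noncomputable section

namespace Summit.ResolutionOfSingularities.ResolutionOfSingularities.Theorems.PIDim4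

namespace ResCone

open MvPolynomial
open Literature.AlgebraicGeometry.Resolution
open Literature.AlgebraicGeometry.Resolution.CentreBlowup
open Literature.AlgebraicGeometry.Resolution.Hauser2010
open Literature.AlgebraicGeometry.Resolution.HauserPerlega2019
open RidgeBudget (NoAboveFloorTrap)

/-- An eventually constant chart letter has no satellite step from that index on. [folklore] -/
theorem not_isSatellite_of_eventuallyConst {K : Type} [Field K] {j : ℕ → Fin 4} {b : ℕ → Fin 4 → K} {k₂ : ℕ}
    (h : ∀ k, k₂ ≤ k → j (k + 1) = j k) {k : ℕ} (hk : k₂ ≤ k) : ¬ FreeTail.IsSatellite j b k :=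
  fun hsat => hsat.1 (h k hk)

/-- **LAYER 1 OF THE C∞ ASSEMBLY** (brick K24c, `p = 5`, `d = 4`): if every witnessed isolated above-floor `Step0 5`
chain of constant shade `4` with `e_G ≡ 3` has an eventually constant chart letter (`hConst` — the composite of
K28 entry, the K24b jet frame and the K24b-α letter-change game, by value), then NO `d = 4` light power-cone trap
exists over any field of characteristic 5: the trap's `(6,6)`-satellite recurrence is impossible along a
constant-chart tail. [OURS · bookkeeping] [folklore] -/
theorem no_light_pair_tail_four_five_of_eventuallyConst
    (hConst : ∀ (K : Type) [Field K] [CharP K 5] [DecidableEq K] (c : ℕ → State K) (j : ℕ → Fin 4)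
      (b : ℕ → Fin 4 → K), (∀ k, IsIsolated 5 (c k).F ∧ Step0 5 (c k) (c (k + 1))) →
      FreeTail.IsWitnessedChain 5 c j b → (∀ e ∈ (c 0).F.support, (c 0).r ≤ e) →
      (∀ k, ordZero (c k).F ≠ (5 : ℕ)) → (∀ k, (c k).shade = ((4 : ℕ) : ℕ∞)) →
      (∀ k, Module.finrank K (resVertex (c k)) = 3) → ∃ k₂, ∀ k, k₂ ≤ k → j (k + 1) = j k)
    (K : Type) [Field K] [CharP K 5] [DecidableEq K] :
    ¬ ∃ (c : ℕ → State K) (j : ℕ → Fin 4) (b : ℕ → Fin 4 → K),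
        (∀ e' ∈ (c 0).F.support, (c 0).r ≤ e') ∧ FreeTail.IsWitnessedChain 5 c j b ∧
        (∀ k, IsIsolated 5 (c k).F ∧ Step0 5 (c k) (c (k + 1)) ∧ ordZero (c k).F ≠ (5 : ℕ) ∧
          (c k).shade = ((4 : ℕ) : ℕ∞) ∧ Module.finrank K (resVertex (c k)) = 3) ∧
        ∀ N, ∃ k, N ≤ k ∧ FreeTail.IsSatellite j b k ∧
          ordZero (c k).F = (6 : ℕ) ∧ ordZero (c (k + 1)).F = (6 : ℕ) := by
  rintro ⟨c, j, b, hr0, hw, hc, hN⟩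
  obtain ⟨k₂, hk₂⟩ := hConst K c j b (fun k => ⟨(hc k).1, (hc k).2.1⟩) hw hr0 (fun k => (hc k).2.2.1)
    (fun k => (hc k).2.2.2.1) (fun k => (hc k).2.2.2.2)
  obtain ⟨k, hk, hsat, -⟩ := hN k₂
  exact not_isSatellite_of_eventuallyConst hk₂ hk hsat

/-- **K2(5) ⟺ (no `d = 2` light power-cone trap) ∧ (no binary-cone trap)** — the holder's slice-B END-STATE
sentence at `p = 5`, MODULO the two-slot killer `hT2` (res-dim4-p-1 g3's K24a, in K27a's dress quantified over
all chains) and the C∞ constancy `hConst` (K24c layer 2).  Composition of res-dim4-p-3's K27b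
`noAboveFloorTrap_five_iff_residual_of_T2` with `no_light_pair_tail_four_five_of_eventuallyConst`.
[OURS · bookkeeping] [cite: CossartJannsenSaito2020, Thm. 3.14] -/
theorem noAboveFloorTrap_five_iff_residual_two_of
    (hT2 : ∀ (K : Type) [Field K] [CharP K 5] [DecidableEq K] (c : ℕ → State K) (j : ℕ → Fin 4)
      (b : ℕ → Fin 4 → K), (∀ k, IsIsolated 5 (c k).F ∧ Step0 5 (c k) (c (k + 1))) →
      FreeTail.IsWitnessedChain 5 c j b → (∀ e ∈ (c 0).F.support, (c 0).r ≤ e) →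
      (∀ k, ordZero (c k).F ≠ (5 : ℕ)) → ∀ k₀ : ℕ, (∀ k, k₀ ≤ k → (c k).shade = ((3 : ℕ) : ℕ∞)) →
      (∀ k, k₀ ≤ k → Module.finrank K (resVertex (c k)) = 3) →
      ∀ (ν : Fin 4) (k₁ : ℕ), k₀ ≤ k₁ → (∀ k, k₁ ≤ k → 1 ≤ (c k).r ν ∧ j k ≠ ν ∧ b k ν = 0) →
      (∀ k, k₁ ≤ k → ∀ i, i ≠ ν → 1 ≤ (c k).r i →
        ∃ t, k₀ ≤ t ∧ t < k ∧ j t = i ∧ ∀ m, t < m → m < k → j m ≠ i ∧ b m i = 0) → False)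
    (hConst : ∀ (K : Type) [Field K] [CharP K 5] [DecidableEq K] (c : ℕ → State K) (j : ℕ → Fin 4)
      (b : ℕ → Fin 4 → K), (∀ k, IsIsolated 5 (c k).F ∧ Step0 5 (c k) (c (k + 1))) →
      FreeTail.IsWitnessedChain 5 c j b → (∀ e ∈ (c 0).F.support, (c 0).r ≤ e) →
      (∀ k, ordZero (c k).F ≠ (5 : ℕ)) → (∀ k, (c k).shade = ((4 : ℕ) : ℕ∞)) →
      (∀ k, Module.finrank K (resVertex (c k)) = 3) → ∃ k₂, ∀ k, k₂ ≤ k → j (k + 1) = j k) :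
    NoAboveFloorTrap 5 5 ↔ ∀ (K : Type) [Field K] [CharP K 5] [DecidableEq K],
      (¬ ∃ (c : ℕ → State K) (j : ℕ → Fin 4) (b : ℕ → Fin 4 → K),
          (∀ e' ∈ (c 0).F.support, (c 0).r ≤ e') ∧ FreeTail.IsWitnessedChain 5 c j b ∧
          (∀ k, IsIsolated 5 (c k).F ∧ Step0 5 (c k) (c (k + 1)) ∧ ordZero (c k).F ≠ (5 : ℕ) ∧
            (c k).shade = ((2 : ℕ) : ℕ∞) ∧ Module.finrank K (resVertex (c k)) = 3) ∧
          ∀ N, ∃ k, N ≤ k ∧ FreeTail.IsSatellite j b k ∧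
            ordZero (c k).F = (6 : ℕ) ∧ ordZero (c (k + 1)).F = (6 : ℕ)) ∧
      (¬ ∃ (c : ℕ → State K) (d : ℕ), 2 ≤ d ∧ d ≤ 4 ∧
          (∀ e' ∈ (c 0).F.support, (c 0).r ≤ e') ∧
          ∀ k, IsIsolated 5 (c k).F ∧ Step0 5 (c k) (c (k + 1)) ∧ ordZero (c k).F ≠ (5 : ℕ) ∧
            (c k).shade = (d : ℕ∞) ∧ Module.finrank K (resVertex (c k)) = 2) := by
  rw [noAboveFloorTrap_five_iff_residual_of_T2 hT2]
  refine forall_congr' fun K => forall_congr' fun _ => forall_congr' fun _ => forall_congr' fun _ => ?_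
  constructor
  · rintro ⟨h2, -, hC⟩
    exact ⟨h2, hC⟩
  · rintro ⟨h2, hC⟩
    exact ⟨h2, no_light_pair_tail_four_five_of_eventuallyConst hConst K, hC⟩

end ResCone

end Summit.ResolutionOfSingularities.ResolutionOfSingularities.Theorems.PIDim4

end
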